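/-
Copyright (c) 2026 the pub-hodgecm-mathlib formalisation cell (harness21).  Prover seat hodgecm-mathlib-K2E4-p14 (g9), Track B ∕ K2-LIT, h413 = `stmt-HodgeConjecture-24833`,
line `K2_E1_TraceFormulaBeta` — MEMO-12R3-Droad item C.9 (deal (235)(e)∕(236) of K2E1-plan (g7)): the TWO-CENTRE edition of the weighted real-axis bound of ★ p860128 ∕ ★ p860161 —
the pole `z₁` of the scalar may differ from the centre `ρ₀` of the four-term (at `N = 3`: `ρ₀ = 2`, second pole `z₁ = 3∕2`, the non-tempered residual spectrum of `U(2,1)`).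
-/
import Summits.HodgeConjecture.HodgeConjecture.Theorems.K2E1MaassSelbergDiagonalRealAxis   -- ★ p860161 (K2E1-p12): generic-`ρ₀` four-term `norm_fourTerm_diag_le`, `exists_norm_outer_le`; brings ★ p860128 §1∕§2
import HarnessLib

/-!
# K2·E1 — `K2E1MaassSelbergDiagonalRealAxisTwoCentres`: `|z − z₁|²·R_{ρ₀}(z, z; c̃)` is bounded near a REAL pole `z₁` of `c̃` with `Re ρ₀ < 2·Re z₁`

Track B ∕ K2-LIT, crux h413 = `stmt-HodgeConjecture-24833`, route of record `HCCMUnconditional`; cell `hodgecm-mathlib`, squad K2, ENGINE E1.  THEOREMS ONLY (no `def`, no `instance`,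
no notation, no named-fact hypothesis, no `sorry`); lane `--supports stmt-HodgeConjecture-24833 --as helper` (count-neutral).  Closes no socket.  Pure analysis.

WHAT.  ★ p860161 `K2E1MaassSelbergDiagonalRealAxis.exists_normSq_mul_norm_fourTerm_diag_le` bounds `|z − ρ₀|²·R_{ρ₀}(z, z; c̃)` near the pole `ρ₀` of `c̃` when that pole sits AT the
centre `ρ₀` of the four-term (`z + z̄ − ρ₀`; `ρ₀ = 2ρ_B`: the pole of the spherical scalar).  On `U(2,1)` the character families have a SECOND real pole `z₁ = 3∕2 ≠ ρ₀ = 2` (residues =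
the non-tempered residual representations); the argument is verbatim with the weight centred at `z₁`: `k₂ := conj(z − z₁)·T^{−(z−z̄)}·d`, `d = (z − z₁)c̃` analytic at `z₁`, is `C¹` and real on
the real trace, so `|z − z₁|²·|Im k| = |Im k₂| ≤ C|Im z|` (★ p860128 §1), while the outer coefficients only need `Re ρ₀ < 2·Re z₁` (★ p860161 `exists_norm_outer_le`).
* HEAD **`exists_normSq_mul_norm_fourTerm_diag_le_twoCentres`** — `(hz₁ : z₁.im = 0) (hρz : ρ₀.re < 2 * z₁.re) (hd : AnalyticAt d z₁) (hdc : d =ᶠ[𝓝[≠] z₁] (z − z₁)·c) (hreal)` ⟹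
  `∃ C, ∀ᶠ z in 𝓝[≠] z₁, z.im ≠ 0 → ‖z − z₁‖²·‖R_{ρ₀}(z,z;c z)‖ ≤ C` (★ p860161's bytes for `R_{ρ₀}`; its head is the instance `z₁ = ρ₀`).
HONEST LABEL: HC_CM is proved only modulo the 7 printed citations (2 remaining named inputs: hLiu418 = `stmt-HodgeConjecture-24832`, h413 = `stmt-HodgeConjecture-24833`) until rung 0
closes; this file asserts no named fact and closes no socket; count-neutral; unconditional.

## References
* [MoeglinWaldspurger1995] C. Mœglin, J.-L. Waldspurger, *Spectral decomposition and Eisenstein series* (1995), IV.2.3, IV.3.12 (a).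
* [Arthur1980TraceFormulaII] J. Arthur, *A trace formula for reductive groups II*, Compositio Math. 40 (1980), §4.
-/

set_option autoImplicit false
-- the mandated namespace repeats the single-problem summit's segment (`HodgeConjecture.HodgeConjecture`)
set_option linter.dupNamespace false

noncomputable section

open Set Filter Topology Metric Complex
open scoped ComplexConjugate
open Summit.HodgeConjecture.HodgeConjecture.Cruxes.H413.K2E1MaassSelbergDiagonalRealAxisCMThree (exists_abs_im_le_mul_abs_im contDiff_cpow_neg_sub_conj)
open Summit.HodgeConjecture.HodgeConjecture.Cruxes.H413.K2E1MaassSelbergDiagonalRealAxis (norm_fourTerm_diag_le exists_norm_outer_le)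

namespace Summit.HodgeConjecture.HodgeConjecture.Cruxes.H413.K2E1MaassSelbergDiagonalRealAxisTwoCentres

/-- **THE `|z − z₁|²`-WEIGHTED FOUR-TERM WITH CENTRE `ρ₀` IS BOUNDED NEAR A REAL POLE `z₁` OF `c̃`** (`Im z₁ = 0`, `Re ρ₀ < 2·Re z₁`; off the real axis), where `(z − z₁)·c̃ = d` near `z₁`
with `d` analytic at `z₁` and `c̃` real at the real points `x ≠ Re z₁` near `z₁`.  (★ p860161's weighted head is the instance `z₁ = ρ₀`; at `N = 3`: `ρ₀ = 2`, `z₁ = 3∕2`.)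
[cite: MoeglinWaldspurger1995, IV.2.3, IV.3.12 (a)] [cite: Arthur1980TraceFormulaII, §4] -/
theorem exists_normSq_mul_norm_fourTerm_diag_le_twoCentres (Cμ CK κ m : ℝ) {T : ℝ} (hT : 0 < T) (φ₀ : ℂ) {ρ₀ z₁ : ℂ} (hz₁ : z₁.im = 0) (hρz : ρ₀.re < 2 * z₁.re)
    {c d : ℂ → ℂ} (hd : AnalyticAt ℂ d z₁) (hdc : ∀ᶠ z in 𝓝[≠] z₁, d z = (z - z₁) * c z) (hreal : ∀ᶠ x : ℝ in 𝓝[≠] z₁.re, (c (x : ℂ)).im = 0) :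
    ∃ C : ℝ, ∀ᶠ z in 𝓝[≠] z₁, z.im ≠ 0 →
      ‖z - z₁‖ ^ 2 * ‖((Cμ : ℝ) : ℂ) * (((CK : ℝ) : ℂ) *
        ((((T : ℝ) : ℂ) ^ (z + conj z - ρ₀) / (z + conj z - ρ₀)) * (((κ : ℝ) : ℂ) * (((m : ℝ) : ℂ) * (φ₀ * conj φ₀)))
          + (((T : ℝ) : ℂ) ^ (z - conj z) / (z - conj z)) * (((κ : ℝ) : ℂ) * (((m : ℝ) : ℂ) * (φ₀ * conj (c z * φ₀))))
          - (((T : ℝ) : ℂ) ^ (-(z - conj z)) / (z - conj z)) * (((κ : ℝ) : ℂ) * (((m : ℝ) : ℂ) * (c z * φ₀ * conj φ₀)))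
          - (((T : ℝ) : ℂ) ^ (-(z + conj z - ρ₀)) / (z + conj z - ρ₀)) * (((κ : ℝ) : ℂ) * (((m : ℝ) : ℂ) * (c z * φ₀ * conj (c z * φ₀))))))‖ ≤ C := by
  have hzeq : ((z₁.re : ℝ) : ℂ) = z₁ := Complex.ext (by simp) (by simp [hz₁])
  -- the outer coefficients near `z₁`, `d` bounded near `z₁`
  obtain ⟨B, hB⟩ := exists_norm_outer_le hT hρz
  obtain ⟨M, hM⟩ : ∃ M : ℝ, ∀ᶠ z in 𝓝 z₁, ‖d z‖ ≤ M :=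
    ⟨‖d z₁‖ + 1, (hd.continuousAt.norm.eventually (Iic_mem_nhds (lt_add_one ‖d z₁‖))).mono fun z hz => hz⟩
  -- `k₂ := conj(z−z₁)·T^{−(z−z̄)}·d` is `C¹` at `z₁` and real on the punctured real trace
  have hk₂ : ContDiffAt ℝ 1 (fun z : ℂ => conj (z - z₁) * (((T : ℝ) : ℂ) ^ (-(z - conj z)) * d z)) ((z₁.re : ℝ) : ℂ) := by
    have hconj : ContDiff ℝ 1 (fun z : ℂ => conj z) := by
      have : (fun z : ℂ => conj z) = ⇑conjCLE := funext fun z => (conjCLE_apply z).symm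
      rw [this]; exact conjCLE.contDiff
    rw [hzeq]
    exact (hconj.comp (contDiff_id.sub contDiff_const)).contDiffAt.mul (((contDiff_cpow_neg_sub_conj hT).contDiffAt).mul (hd.contDiffAt.restrict_scalars ℝ))
  have hdc' : ∀ᶠ x : ℝ in 𝓝[≠] z₁.re, d (x : ℂ) = ((x : ℂ) - z₁) * c (x : ℂ) := by
    have ht : Tendsto (fun x : ℝ => (x : ℂ)) (𝓝[≠] z₁.re) (𝓝[≠] z₁) := by
      refine tendsto_nhdsWithin_of_tendsto_nhds_of_eventually_within _ ((continuous_ofReal.tendsto' _ _ hzeq).mono_left nhdsWithin_le_nhds) ?_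
      filter_upwards [self_mem_nhdsWithin] with x hx
      exact fun h => hx (by
        rw [mem_singleton_iff] at h ⊢
        have := congrArg Complex.re h
        simpa only [ofReal_re] using this)
    exact ht.eventually hdc
  have hk₂real : ∀ᶠ x : ℝ in 𝓝[≠] z₁.re, ((fun z : ℂ => conj (z - z₁) * (((T : ℝ) : ℂ) ^ (-(z - conj z)) * d z)) (x : ℂ)).im = 0 := by
    filter_upwards [hreal, hdc'] with x hx hxd
    simp only [hxd]
    rw [← hzeq, ← ofReal_sub, conj_ofReal, conj_ofReal, sub_self, neg_zero, cpow_zero, one_mul, ← mul_assoc, ← ofReal_mul, im_ofReal_mul, hx, mul_zero]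
  obtain ⟨C₁, hC₁⟩ := exists_abs_im_le_mul_abs_im hk₂ hk₂real
  rw [hzeq] at hC₁
  set K₀ : ℝ := ‖((Cμ : ℝ) : ℂ) * (((CK : ℝ) : ℂ) * (((κ : ℝ) : ℂ) * (((m : ℝ) : ℂ) * (φ₀ * conj φ₀))))‖ with hK₀
  refine ⟨K₀ * (B + C₁ + B * M ^ 2), ?_⟩
  have hball : ∀ᶠ z in 𝓝[≠] z₁, ‖z - z₁‖ ≤ 1 := by
    filter_upwards [mem_nhdsWithin_of_mem_nhds (Metric.closedBall_mem_nhds z₁ one_pos)] with z hz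
    rwa [Metric.mem_closedBall, dist_eq_norm] at hz
  filter_upwards [mem_nhdsWithin_of_mem_nhds hB, mem_nhdsWithin_of_mem_nhds hC₁, mem_nhdsWithin_of_mem_nhds hM, hdc, hball] with z hzB hzC hzM hzd hz1 hzim
  have hB0 : 0 ≤ B := (norm_nonneg _).trans hzB.1
  have hsq : ‖z - z₁‖ ^ 2 ≤ 1 := by nlinarith [norm_nonneg (z - z₁)]
  -- `|z−z₁|²·|Im k| = |Im k₂|`
  have hk₂eq : (((‖z - z₁‖ ^ 2 : ℝ)) : ℂ) * (((T : ℝ) : ℂ) ^ (-(z - conj z)) * c z) = conj (z - z₁) * (((T : ℝ) : ℂ) ^ (-(z - conj z)) * d z) := by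
    rw [hzd, ofReal_pow, ← conj_mul' (z - z₁)]; ring
  have hmid : ‖z - z₁‖ ^ 2 * (|(((T : ℝ) : ℂ) ^ (-(z - conj z)) * c z).im| / |z.im|) ≤ C₁ := by
    rw [← mul_div_assoc, div_le_iff₀ (abs_pos.2 hzim), ← abs_of_nonneg (sq_nonneg ‖z - z₁‖), ← abs_mul, ← im_ofReal_mul, hk₂eq]
    exact hzC
  calc ‖z - z₁‖ ^ 2 * _ ≤ ‖z - z₁‖ ^ 2 * (K₀ * (‖((T : ℝ) : ℂ) ^ (z + conj z - ρ₀) / (z + conj z - ρ₀)‖ + |(((T : ℝ) : ℂ) ^ (-(z - conj z)) * c z).im| / |z.im|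
          + ‖((T : ℝ) : ℂ) ^ (-(z + conj z - ρ₀)) / (z + conj z - ρ₀)‖ * ‖c z‖ ^ 2)) :=
        mul_le_mul_of_nonneg_left (norm_fourTerm_diag_le Cμ CK κ m hT φ₀ ρ₀ (c z) z) (sq_nonneg _)
    _ = K₀ * (‖z - z₁‖ ^ 2 * ‖((T : ℝ) : ℂ) ^ (z + conj z - ρ₀) / (z + conj z - ρ₀)‖ + ‖z - z₁‖ ^ 2 * (|(((T : ℝ) : ℂ) ^ (-(z - conj z)) * c z).im| / |z.im|)
          + ‖((T : ℝ) : ℂ) ^ (-(z + conj z - ρ₀)) / (z + conj z - ρ₀)‖ * (‖z - z₁‖ * ‖c z‖) ^ 2) := by ring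
    _ ≤ K₀ * (B + C₁ + B * M ^ 2) := by
        refine mul_le_mul_of_nonneg_left (add_le_add (add_le_add ?_ hmid) ?_) (norm_nonneg _)
        · exact (mul_le_mul hsq hzB.1 (norm_nonneg _) zero_le_one).trans_eq (one_mul B)
        · refine mul_le_mul hzB.2 (pow_le_pow_left₀ (by positivity) ?_ 2) (sq_nonneg _) hB0
          rw [← norm_mul, ← hzd]; exact hzM

end Summit.HodgeConjecture.HodgeConjecture.Cruxes.H413.K2E1MaassSelbergDiagonalRealAxisTwoCentres

end
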